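import Literature.LinearAlgebra.TensorSlot.SlotOperators
import Mathlib.LinearAlgebra.TensorProduct.Basic
import Mathlib.RingTheory.Adjoin.Basic

/-!
# Cyclic vectors for a family of operators; multiplicativity under `⊗` and `⨂`

Topic `LinearAlgebra/TensorSlot`; continues `SlotOperators`.  A vector `v` of an `R`-module `V` is CYCLIC for
a family of endomorphisms `X : κ → Module.End R V` when the only `X`-stable submodule containing `v` is `V`
itself — equivalently (`isCyclicVector_iff_forall_exists_adjoin`) when every vector is `a v` for some `a` in
the subalgebra of `Module.End R V` generated by the `X k` ("`V = R⟨X⟩ · v`", the cyclic module generated by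
`v`).

* `IsCyclicVector X v` — the predicate (an induction principle: to prove a submodule is everything, show it
  contains `v` and is `X`-stable); `IsCyclicVector.of_comp` (more operators), `IsCyclicVector.restrict`
  (passage to a stable submodule), `isCyclicVector_iff_forall_exists_adjoin`;
* **multiplicativity** [folklore] ("`U(𝔤 ⊕ 𝔥) = U(𝔤) ⊗ U(𝔥)`: the outer tensor product of cyclic modules
  is cyclic for the factorwise operators, generated by the tensor of the generators"):
  `IsCyclicVector.tmul` — `M = R⟨X⟩ m₀`, `N = R⟨Y⟩ n₀ ⇒ M ⊗ N = R⟨X ⊗ 1, 1 ⊗ Y⟩ (m₀ ⊗ n₀)`;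
  `IsCyclicVector.piTensorProduct` — the same for a FINITE family, with the single-slot operators
  `TensorSlot.slot i (X i k)` of `SlotOperators` and the pure tensor `⨂ₜ φ` of the generators.

Everything is proved, Mathlib (+ `SlotOperators`) only.  Not here: topological cyclicity (dense orbit) — see
`Literature.MathematicalPhysics.AQFT.IsCyclicVector` for von Neumann algebras; this file is purely algebraic.

## Provenance

Reproduced for the tree under the LEAN-IN-TREE rule (2026-08-18) from the pub-hodgecm cell's package files
`HodgeCM/PerL34/ArchBGen.lean` §1 (`IsGeneratedBy`, `isGeneratedBy_tmul`, `isGeneratedBy_restrict`; DAG-node prover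
#12 lineage, seat pv12-g1, gate run 21) and `HodgeCM/PerL34/ArchCFock.lean` §1 (`isGeneratedBy_piTensor`; seat
pv12-g2, gate run 21), generalised from `ℂ` to a (commutative) semiring, with the `adjoin` characterisation added.
-/

set_option autoImplicit false

open Function PiTensorProduct
open scoped TensorProduct

namespace Literature.LinearAlgebra.TensorSlot

/-! ## The predicate -/

section Semiring

variable {R : Type*} [Semiring R] {V : Type*} [AddCommMonoid V] [Module R V] {κ : Type*}

/-- `v` is a **cyclic vector** for the operator family `X : κ → Module.End R V`: the only submodule of `V`
that contains `v` and is stable under every `X k` is `⊤` (i.e. `V` is generated by `v` as a module over the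
algebra generated by the `X k`). [folklore] -/
def IsCyclicVector (X : κ → Module.End R V) (v : V) : Prop :=
  ∀ N : Submodule R V, v ∈ N → (∀ k, ∀ w ∈ N, X k w ∈ N) → N = ⊤

/-- Enlarging the operator family keeps a cyclic vector cyclic: if `v` is cyclic for the sub-family
`X ∘ e`, it is cyclic for `X`. [folklore] -/
theorem IsCyclicVector.of_comp {κ' : Type*} {X : κ → Module.End R V} {v : V} (e : κ' → κ)
    (h : IsCyclicVector (X ∘ e) v) : IsCyclicVector X v :=
  fun N hv hN => h N hv fun k w hw => hN (e k) w hw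

/-- A cyclic vector for operators that preserve a submodule `K ∋ v`, in the ambient form "every `X`-stable
submodule containing `v` contains `K`", gives a cyclic vector of `K` for the restricted operators. [folklore] -/
theorem IsCyclicVector.restrict (K : Submodule R V) (X : κ → Module.End R V) (hX : ∀ k, ∀ w ∈ K, X k w ∈ K)
    {v : V} (hv : v ∈ K) (hgen : ∀ N : Submodule R V, v ∈ N → (∀ k, ∀ w ∈ N, X k w ∈ N) → K ≤ N) :
    IsCyclicVector (fun k => (X k).restrict (hX k)) (⟨v, hv⟩ : K) := by
  intro N hN0 hN
  have hle := hgen (N.map K.subtype) ⟨⟨v, hv⟩, hN0, rfl⟩ (by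
    rintro k _ ⟨x, hx, rfl⟩
    exact ⟨(X k).restrict (hX k) x, hN k x hx, rfl⟩)
  rw [eq_top_iff]
  rintro x -
  obtain ⟨y, hy, hyx⟩ := hle x.2
  have : y = x := Subtype.ext hyx
  rwa [this] at hy

/-- Conversely, a cyclic vector of `V` makes every `X`-stable submodule containing it equal to `⊤`; in
particular the `X`-orbit data determine linear maps: two linear maps out of `V` that agree on `v` and whose
equaliser is `X`-stable are equal. [folklore] -/
theorem IsCyclicVector.linearMap_ext {W : Type*} [AddCommMonoid W] [Module R W] {X : κ → Module.End R V}
    {v : V} (h : IsCyclicVector X v) {F G : V →ₗ[R] W} (hv : F v = G v)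
    (hX : ∀ k w, F w = G w → F (X k w) = G (X k w)) : F = G := by
  have htop := h (LinearMap.eqLocus F G) hv fun k w hw => hX k w hw
  exact LinearMap.ext fun w => (LinearMap.eqLocus_eq_top).1 htop ▸ rfl

end Semiring

/-! ## The `adjoin` characterisation -/

section CommSemiring

variable {R : Type*} [CommSemiring R] {V : Type*} [AddCommMonoid V] [Module R V] {κ : Type*}

/-- Every element of the subalgebra generated by the `X k` maps an `X`-stable submodule into itself.
[folklore] -/
theorem mem_of_mem_adjoin {X : κ → Module.End R V} {N : Submodule R V} (hN : ∀ k, ∀ w ∈ N, X k w ∈ N)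
    {a : Module.End R V} (ha : a ∈ Algebra.adjoin R (Set.range X)) {w : V} (hw : w ∈ N) : a w ∈ N := by
  induction ha using Algebra.adjoin_induction generalizing w with
  | mem x hx =>
      obtain ⟨k, rfl⟩ := hx
      exact hN k w hw
  | algebraMap r =>
      rw [Module.algebraMap_end_apply]
      exact N.smul_mem r hw
  | add x y _ _ hx hy =>
      rw [LinearMap.add_apply]
      exact N.add_mem (hx hw) (hy hw)
  | mul x y _ _ hx hy =>
      rw [Module.End.mul_apply]
      exact hx (hy hw)

/-- **`v` is cyclic iff `V = R⟨X⟩ · v`:** every vector is `a v` for some `a` in the subalgebra of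
`Module.End R V` generated by the operators `X k`. [folklore] -/
theorem isCyclicVector_iff_forall_exists_adjoin (X : κ → Module.End R V) (v : V) :
    IsCyclicVector X v ↔ ∀ w : V, ∃ a ∈ Algebra.adjoin R (Set.range X), a v = w := by
  constructor
  · intro h w
    -- the orbit `R⟨X⟩ · v` is an `X`-stable submodule containing `v`
    let N : Submodule R V :=
      (Subalgebra.toSubmodule (Algebra.adjoin R (Set.range X))).map (LinearMap.applyₗ v)
    have hmem : ∀ u : V, u ∈ N ↔ ∃ a ∈ Algebra.adjoin R (Set.range X), a v = u := fun u => by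
      simp only [N, Submodule.mem_map, Subalgebra.mem_toSubmodule, LinearMap.applyₗ_apply_apply]
    have hN : N = ⊤ := by
      refine h N ((hmem v).2 ⟨1, Subalgebra.one_mem _, rfl⟩) fun k u hu => ?_
      obtain ⟨a, ha, rfl⟩ := (hmem u).1 hu
      exact (hmem _).2 ⟨X k * a, Subalgebra.mul_mem _ (Algebra.subset_adjoin ⟨k, rfl⟩) ha, rfl⟩
    exact (hmem w).1 (hN ▸ Submodule.mem_top)
  · intro h N hv hN
    rw [eq_top_iff]
    rintro w -
    obtain ⟨a, ha, rfl⟩ := h w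
    exact mem_of_mem_adjoin hN ha hv

/-- A cyclic vector for `X` is moved onto any vector by the generated algebra; in particular a linear map
vanishing on the whole orbit `R⟨X⟩ · v` vanishes. [folklore] -/
theorem IsCyclicVector.exists_adjoin_apply_eq {X : κ → Module.End R V} {v : V} (h : IsCyclicVector X v)
    (w : V) : ∃ a ∈ Algebra.adjoin R (Set.range X), a v = w :=
  (isCyclicVector_iff_forall_exists_adjoin X v).1 h w

end CommSemiring

/-! ## Multiplicativity under the binary tensor product -/

section Tmul

variable {R : Type*} [CommSemiring R]
variable {M : Type*} [AddCommMonoid M] [Module R M] {N : Type*} [AddCommMonoid N] [Module R N]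

/-- **Cyclic vectors are multiplicative under `⊗`.**  If `m₀` is cyclic in `M` for `X` and `n₀` is cyclic in
`N` for `Y`, then `m₀ ⊗ₜ n₀` is cyclic in `M ⊗[R] N` for the factorwise family `X k ⊗ 1`, `1 ⊗ Y l`
(indexed by `κ ⊕ κ'`). [folklore] -/
theorem IsCyclicVector.tmul {κ κ' : Type*} {X : κ → Module.End R M} {Y : κ' → Module.End R N} {m₀ : M}
    {n₀ : N} (hM : IsCyclicVector X m₀) (hN : IsCyclicVector Y n₀) :
    IsCyclicVector (Sum.elim (fun k => (X k).rTensor N) (fun l => (Y l).lTensor M)) (m₀ ⊗ₜ[R] n₀) := by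
  intro S h0 hS
  have step1 : ∀ m : M, m ⊗ₜ[R] n₀ ∈ S := by
    have h := hM (S.comap ((TensorProduct.mk R M N).flip n₀)) (by simpa using h0) ?_
    · intro m
      have hm : m ∈ (⊤ : Submodule R M) := Submodule.mem_top
      rw [← h] at hm
      simpa using hm
    · intro k φ hφ
      simp only [Submodule.mem_comap, LinearMap.flip_apply, TensorProduct.mk_apply] at hφ ⊢
      simpa using hS (Sum.inl k) _ hφ
  have step2 : ∀ (m : M) (n : N), m ⊗ₜ[R] n ∈ S := by
    intro m
    have h := hN (S.comap (TensorProduct.mk R M N m)) (by simpa using step1 m) ?_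
    · intro n
      have hn : n ∈ (⊤ : Submodule R N) := Submodule.mem_top
      rw [← h] at hn
      simpa using hn
    · intro l φ hφ
      simp only [Submodule.mem_comap, TensorProduct.mk_apply] at hφ ⊢
      simpa using hS (Sum.inr l) _ hφ
  rw [eq_top_iff, ← TensorProduct.span_tmul_eq_top, Submodule.span_le]
  rintro _ ⟨m, n, rfl⟩
  exact step2 m n

end Tmul

/-! ## Multiplicativity under the tensor product of a finite family -/

section PiTensor

variable {ι : Type*} [Finite ι] [DecidableEq ι] {R : Type*} [CommSemiring R]
variable {s : ι → Type*} [∀ i, AddCommMonoid (s i)] [∀ i, Module R (s i)]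

/-- **Cyclic vectors are multiplicative under `⨂` (finite family).**  If each `φ i` is cyclic in `s i` for
the family `X i : κ i → Module.End R (s i)`, then the pure tensor `⨂ₜ φ` is cyclic in `⨂[R] i, s i` for the
family of all single-slot operators `slot i (X i k)`, indexed by `Σ i, κ i`.  (Proof: by induction on a finite
set of "freed" slots, every pure tensor agreeing with `φ` outside that set lies in any slot-stable submodule
containing `⨂ₜ φ`; pure tensors span.) [folklore] -/
theorem IsCyclicVector.piTensorProduct {κ : ι → Type*} (X : ∀ i, κ i → Module.End R (s i))
    {φ : Π i, s i} (h : ∀ i, IsCyclicVector (X i) (φ i)) :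
    IsCyclicVector (fun p : Σ i, κ i => slot p.1 (X p.1 p.2)) (tprod R φ) := by
  intro S h0 hS
  -- every pure tensor that agrees with `φ` outside a finite set `t` of freed slots lies in `S`
  have key : ∀ (t : Finset ι) (m : Π i, s i), (∀ i, i ∉ t → m i = φ i) → tprod R m ∈ S := by
    intro t
    induction t using Finset.induction_on with
    | empty =>
        intro m hm
        have hmφ : m = φ := funext fun i => hm i (by simp)
        rw [hmφ]
        exact h0
    | insert a t ha ih =>
        intro m hm
        -- vary slot `a` linearly, all other slots of `m` fixed
        let L : s a →ₗ[R] ⨂[R] i, s i := (tprod R).toLinearMap m a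
        have hL : ∀ x, L x = tprod R (update m a x) := fun _ => rfl
        have hcomap : S.comap L = ⊤ := by
          refine h a (S.comap L) ?_ ?_
          · show L (φ a) ∈ S
            rw [hL]
            refine ih _ fun i hi => ?_
            by_cases hia : i = a
            · subst hia
              rw [update_self]
            · rw [update_of_ne hia]
              exact hm i (by simp [hia, hi])
          · intro k x hx
            show L (X a k x) ∈ S
            have hx' : slot a (X a k) (L x) ∈ S := hS ⟨a, k⟩ (L x) hx
            rw [hL, slot_tprod, update_idem, update_self] at hx'
            rw [hL]
            exact hx'
        have hma : m a ∈ S.comap L := by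
          rw [hcomap]
          exact Submodule.mem_top
        rw [Submodule.mem_comap, hL, update_eq_self] at hma
        exact hma
  have _inst : Fintype ι := Fintype.ofFinite ι
  rw [eq_top_iff, ← PiTensorProduct.span_tprod_eq_top, Submodule.span_le]
  rintro _ ⟨m, rfl⟩
  exact key Finset.univ m fun i hi => absurd (Finset.mem_univ i) hi

end PiTensor

end Literature.LinearAlgebra.TensorSlot
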